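import Summits.AtomisticToContinuum.HydrodynamicLimit.Theorems.ImplosionDichotomyPolynomialCompressionShadowingDefs
import Literature.Analysis.FunctionSpaces.TorusDerivSizeBounds

/-!
# Objects of the level-3 estimate (line `log-lipschitz-budget`, crux `PolynomialCompression`, stub 4)

Definitions file for the proof of `stub_logBudgetShadowing` of the crux `ImplosionDichotomy.PolynomialCompression`
(stmt-AtomisticToContinuum-12587). For a word `(l, m, n)` the top field is `W = ∂ₙ∂ₘ∂ₗ δV`,
`δV = (ρ - ρ₁, u - u₁, θ - θ₁)` (σ-solution minus ideal-gas reference). This file only NAMES the long expressions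
shared by the level-3 files, so that their statements stay short and literally equal:

* `l3Fρ`, `l3Fu`, `l3Fθ` — the frozen operator applied to `W` (left-hand sides of `hsEuler_level3_forcing_*` with the
  reference `(ρ₁, u₁, θ₁)`);
* `l3Topρ`, `l3Topu`, `l3Topθ` — their TOP-ORDER parts: the linear forcing with `δV ↦ W` and the three one-step
  commutators with all derivatives on `δV` (coefficients: the σ-solution's `∂u`, `∂ρ`, `∂A`, `∂ζ(ρ)`, `∂(θζ(ρ))`);
* `l3Rem` — the crude remainder polynomial `40M((d₀+d₁)(1+S₂+S₃) + d₂(1+S₂)) + Z(1+S₂+S₃)`;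
* `Level3Coeff` — the common third-order envelope `(M, Z, S₂, S₃)` of the coefficient functions at a point
  (`Torus.HasDerivBoundsAt₃`); `Level3Jets` — bounds `d₀, d₁, d₂` of the jets of `δV` of orders `0, 1, 2` at a point;
  `l3q`, `l3n` — total second/third derivative sizes of `δV` at a point;
* `l3e` (energy density of `W` as a space–time field), `l3flux` (its fluxes), `l3Y` (the energies of the commutator
  jets `Y`), `l3Nw` (weighted magnitude of `W`), `l3Ws` (sum of the root weights).

Nothing is asserted beyond two elementary order facts.
-/

noncomputable section

namespace Summit.AtomisticToContinuum.HydrodynamicLimit.Theorems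

open Set MeasureTheory
open Literature.MathematicalPhysics.KineticTheory Literature.Analysis.FunctionSpaces

/-- Density component of the frozen operator at `W = ∂ₙ∂ₘ∂ₗ δV` (left-hand side of
`hsEuler_level3_forcing_density`). [folklore] -/
def l3Fρ (T : ℝ) (ρ ρ₁ : ℝ → T3 → ℝ) (u u₁ : ℝ → T3 → V3) (t : ℝ) (x : T3) (l m n : Fin 3) : ℝ :=
  Torus.timeDerivWithin (Ico 0 T) (fun s => Torus.partialDeriv n (Torus.partialDeriv m
      (Torus.partialDeriv l (fun y => ρ s y - ρ₁ s y)))) t x +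
    ∑ i, u t x i * Torus.partialDeriv i (Torus.partialDeriv n (Torus.partialDeriv m
      (Torus.partialDeriv l (fun y => ρ t y - ρ₁ t y)))) x +
    ρ t x * ∑ i, Torus.partialDeriv i (fun y => Torus.partialDeriv n (Torus.partialDeriv m
      (Torus.partialDeriv l (fun z => u t z - u₁ t z))) y i) x

/-- `j`-th velocity component of the frozen operator at `W = ∂ₙ∂ₘ∂ₗ δV` (left-hand side of
`hsEuler_level3_forcing_velocity`, law `ζ`). [folklore] -/
def l3Fu (T : ℝ) (ζ : ℝ → ℝ) (ρ θ ρ₁ θ₁ : ℝ → T3 → ℝ) (u u₁ : ℝ → T3 → V3) (t : ℝ) (x : T3)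
    (l m n j : Fin 3) : ℝ :=
  Torus.timeDerivWithin (Ico 0 T) (fun s y => Torus.partialDeriv n (Torus.partialDeriv m
      (Torus.partialDeriv l (fun y => u s y - u₁ s y))) y j) t x +
    ∑ i, u t x i * Torus.partialDeriv i (fun y => Torus.partialDeriv n (Torus.partialDeriv m
      (Torus.partialDeriv l (fun z => u t z - u₁ t z))) y j) x +
    θ t x * (ζ (ρ t x) + ρ t x * deriv ζ (ρ t x)) / ρ t x *
      Torus.partialDeriv j (Torus.partialDeriv n (Torus.partialDeriv m (Torus.partialDeriv l
        (fun y => ρ t y - ρ₁ t y)))) x +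
    ζ (ρ t x) * Torus.partialDeriv j (Torus.partialDeriv n (Torus.partialDeriv m (Torus.partialDeriv l
        (fun y => θ t y - θ₁ t y)))) x

/-- Temperature component of the frozen operator at `W = ∂ₙ∂ₘ∂ₗ δV` (left-hand side of
`hsEuler_level3_forcing_temperature`, law `ζ`). [folklore] -/
def l3Fθ (T : ℝ) (ζ : ℝ → ℝ) (ρ θ θ₁ : ℝ → T3 → ℝ) (u u₁ : ℝ → T3 → V3) (t : ℝ) (x : T3) (l m n : Fin 3) : ℝ :=
  Torus.timeDerivWithin (Ico 0 T) (fun s => Torus.partialDeriv n (Torus.partialDeriv m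
      (Torus.partialDeriv l (fun y => θ s y - θ₁ s y)))) t x +
    ∑ i, u t x i * Torus.partialDeriv i (Torus.partialDeriv n (Torus.partialDeriv m
      (Torus.partialDeriv l (fun y => θ t y - θ₁ t y)))) x +
    2 / 3 * (θ t x * ζ (ρ t x)) * ∑ i, Torus.partialDeriv i (fun y => Torus.partialDeriv n
      (Torus.partialDeriv m (Torus.partialDeriv l (fun z => u t z - u₁ t z))) y i) x

/-- Top-order part of `l3Fρ`: `-(W_ρ div u₁ + Σᵢ W_uᵢ ∂ᵢρ₁)` minus the three commutator tops
`Σᵢ ∂_p uᵢ · Y^p_ρ,i + ∂_p ρ · Σᵢ Y^p_u,i,i`, `p ∈ {l, m, n}`. [folklore] -/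
def l3Topρ (ρ ρ₁ : ℝ → T3 → ℝ) (u u₁ : ℝ → T3 → V3) (t : ℝ) (x : T3) (l m n : Fin 3) : ℝ :=
  -(Torus.partialDeriv n (Torus.partialDeriv m (Torus.partialDeriv l (fun y => ρ t y - ρ₁ t y))) x *
        ∑ i, Torus.partialDeriv i (fun z => u₁ t z i) x) -
      ∑ i, Torus.partialDeriv n (Torus.partialDeriv m (Torus.partialDeriv l
        (fun y => u t y i - u₁ t y i))) x * Torus.partialDeriv i (ρ₁ t) x -
    (∑ i, Torus.partialDeriv l (fun y => u t y i) x *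
        Torus.partialDeriv n (Torus.partialDeriv m (Torus.partialDeriv i (fun y => ρ t y - ρ₁ t y))) x +
      Torus.partialDeriv l (ρ t) x *
        ∑ i, Torus.partialDeriv n (Torus.partialDeriv m (Torus.partialDeriv i
          (fun y => u t y i - u₁ t y i))) x) -
    (∑ i, Torus.partialDeriv m (fun y => u t y i) x *
        Torus.partialDeriv n (Torus.partialDeriv i (Torus.partialDeriv l (fun y => ρ t y - ρ₁ t y))) x +
      Torus.partialDeriv m (ρ t) x *
        ∑ i, Torus.partialDeriv n (Torus.partialDeriv i (Torus.partialDeriv l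
          (fun y => u t y i - u₁ t y i))) x) -
    (∑ i, Torus.partialDeriv n (fun y => u t y i) x *
        Torus.partialDeriv i (Torus.partialDeriv m (Torus.partialDeriv l (fun y => ρ t y - ρ₁ t y))) x +
      Torus.partialDeriv n (ρ t) x *
        ∑ i, Torus.partialDeriv i (Torus.partialDeriv m (Torus.partialDeriv l
          (fun y => u t y i - u₁ t y i))) x)

/-- Top-order part of `l3Fu` (pressure-coefficient difference split as
`θγ/ρ - θ₁/ρ₁ = δθ·γ/ρ + θ₁(γ - 1)/ρ - δρ·θ₁/(ρρ₁)`, `γ = ζ + ρζ'`; the `θ₁(γ-1)/ρ` and `ζ - 1` terms are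
equation-of-state forcing and belong to the remainder). [folklore] -/
def l3Topu (ζ : ℝ → ℝ) (ρ θ ρ₁ θ₁ : ℝ → T3 → ℝ) (u u₁ : ℝ → T3 → V3) (t : ℝ) (x : T3)
    (l m n j : Fin 3) : ℝ :=
  -(∑ i, Torus.partialDeriv n (Torus.partialDeriv m (Torus.partialDeriv l
          (fun y => u t y i - u₁ t y i))) x * Torus.partialDeriv i (fun z => u₁ t z j) x) -
      Torus.partialDeriv n (Torus.partialDeriv m (Torus.partialDeriv l (fun y => θ t y - θ₁ t y))) x *
        ((ζ (ρ t x) + ρ t x * deriv ζ (ρ t x)) / ρ t x * Torus.partialDeriv j (ρ₁ t) x) +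
      Torus.partialDeriv n (Torus.partialDeriv m (Torus.partialDeriv l (fun y => ρ t y - ρ₁ t y))) x *
        (θ₁ t x / (ρ t x * ρ₁ t x) * Torus.partialDeriv j (ρ₁ t) x) -
    (∑ i, Torus.partialDeriv l (fun y => u t y i) x *
        Torus.partialDeriv n (Torus.partialDeriv m (Torus.partialDeriv i (fun y => u t y j - u₁ t y j))) x +
      Torus.partialDeriv l (fun y => θ t y * (ζ (ρ t y) + ρ t y * deriv ζ (ρ t y)) / ρ t y) x *
        Torus.partialDeriv n (Torus.partialDeriv m (Torus.partialDeriv j (fun y => ρ t y - ρ₁ t y))) x +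
      Torus.partialDeriv l (fun y => ζ (ρ t y)) x *
        Torus.partialDeriv n (Torus.partialDeriv m (Torus.partialDeriv j (fun y => θ t y - θ₁ t y))) x) -
    (∑ i, Torus.partialDeriv m (fun y => u t y i) x *
        Torus.partialDeriv n (Torus.partialDeriv i (Torus.partialDeriv l (fun y => u t y j - u₁ t y j))) x +
      Torus.partialDeriv m (fun y => θ t y * (ζ (ρ t y) + ρ t y * deriv ζ (ρ t y)) / ρ t y) x *
        Torus.partialDeriv n (Torus.partialDeriv j (Torus.partialDeriv l (fun y => ρ t y - ρ₁ t y))) x +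
      Torus.partialDeriv m (fun y => ζ (ρ t y)) x *
        Torus.partialDeriv n (Torus.partialDeriv j (Torus.partialDeriv l (fun y => θ t y - θ₁ t y))) x) -
    (∑ i, Torus.partialDeriv n (fun y => u t y i) x *
        Torus.partialDeriv i (Torus.partialDeriv m (Torus.partialDeriv l (fun y => u t y j - u₁ t y j))) x +
      Torus.partialDeriv n (fun y => θ t y * (ζ (ρ t y) + ρ t y * deriv ζ (ρ t y)) / ρ t y) x *
        Torus.partialDeriv j (Torus.partialDeriv m (Torus.partialDeriv l (fun y => ρ t y - ρ₁ t y))) x +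
      Torus.partialDeriv n (fun y => ζ (ρ t y)) x *
        Torus.partialDeriv j (Torus.partialDeriv m (Torus.partialDeriv l (fun y => θ t y - θ₁ t y))) x)

/-- Top-order part of `l3Fθ` (`θζ - θ₁ = δθ·ζ + θ₁(ζ - 1)`; the `θ₁(ζ - 1)` term is forcing). [folklore] -/
def l3Topθ (ζ : ℝ → ℝ) (ρ θ θ₁ : ℝ → T3 → ℝ) (u u₁ : ℝ → T3 → V3) (t : ℝ) (x : T3) (l m n : Fin 3) : ℝ :=
  -(∑ i, Torus.partialDeriv n (Torus.partialDeriv m (Torus.partialDeriv l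
          (fun y => u t y i - u₁ t y i))) x * Torus.partialDeriv i (θ₁ t) x) -
      2 / 3 * Torus.partialDeriv n (Torus.partialDeriv m (Torus.partialDeriv l (fun y => θ t y - θ₁ t y))) x *
        (ζ (ρ t x) * ∑ i, Torus.partialDeriv i (fun z => u₁ t z i) x) -
    (∑ i, Torus.partialDeriv l (fun y => u t y i) x *
        Torus.partialDeriv n (Torus.partialDeriv m (Torus.partialDeriv i (fun y => θ t y - θ₁ t y))) x +
      2 / 3 * Torus.partialDeriv l (fun y => θ t y * ζ (ρ t y)) x *
        ∑ i, Torus.partialDeriv n (Torus.partialDeriv m (Torus.partialDeriv i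
          (fun y => u t y i - u₁ t y i))) x) -
    (∑ i, Torus.partialDeriv m (fun y => u t y i) x *
        Torus.partialDeriv n (Torus.partialDeriv i (Torus.partialDeriv l (fun y => θ t y - θ₁ t y))) x +
      2 / 3 * Torus.partialDeriv m (fun y => θ t y * ζ (ρ t y)) x *
        ∑ i, Torus.partialDeriv n (Torus.partialDeriv i (Torus.partialDeriv l
          (fun y => u t y i - u₁ t y i))) x) -
    (∑ i, Torus.partialDeriv n (fun y => u t y i) x *
        Torus.partialDeriv i (Torus.partialDeriv m (Torus.partialDeriv l (fun y => θ t y - θ₁ t y))) x +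
      2 / 3 * Torus.partialDeriv n (fun y => θ t y * ζ (ρ t y)) x *
        ∑ i, Torus.partialDeriv i (Torus.partialDeriv m (Torus.partialDeriv l
          (fun y => u t y i - u₁ t y i))) x)

/-- The crude remainder polynomial `40M((d₀+d₁)(1+S₂+S₃) + d₂(1+S₂)) + Z(1+S₂+S₃)`. [folklore] -/
def l3Rem (M Z S₂ S₃ d₀ d₁ d₂ : ℝ) : ℝ :=
  40 * M * ((d₀ + d₁) * (1 + S₂ + S₃) + d₂ * (1 + S₂)) + Z * (1 + S₂ + S₃)

/-- **Common third-order envelope of the level-3 coefficient functions at `x`** (time slice `t`): the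
σ-solution's `uᵢ`, `ρ` (orders `1–3`), the weight `A = θγ(ρ)/ρ`, `ζ(ρ)`, `θζ(ρ)`, the reference coefficients
`div u₁, ∂ᵢρ₁, ∂ᵢu₁ⱼ, ∂ᵢθ₁`, the split pressure coefficients `γ(ρ)/ρ ∂ⱼρ₁`, `θ₁ ∂ⱼρ₁/(ρρ₁)`, `ζ(ρ) div u₁` with
constant `M`, and the equation-of-state forcings with the (small) constant `Z`, all against the sizes `S₂, S₃`.
[folklore] -/
def Level3Coeff (ζ : ℝ → ℝ) (ρ θ ρ₁ θ₁ : ℝ → T3 → ℝ) (u u₁ : ℝ → T3 → V3) (t : ℝ) (x : T3)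
    (M Z S₂ S₃ : ℝ) : Prop :=
  (∀ i a, |Torus.partialDeriv a (fun y => u t y i) x| ≤ M) ∧
  (∀ i a b, |Torus.partialDeriv b (Torus.partialDeriv a (fun y => u t y i)) x| ≤ M * (1 + S₂)) ∧
  (∀ i a b c, |Torus.partialDeriv c (Torus.partialDeriv b (Torus.partialDeriv a (fun y => u t y i))) x| ≤
    M * (1 + S₂ + S₃)) ∧
  (∀ a, |Torus.partialDeriv a (ρ t) x| ≤ M) ∧
  (∀ a b, |Torus.partialDeriv b (Torus.partialDeriv a (ρ t)) x| ≤ M * (1 + S₂)) ∧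
  (∀ a b c, |Torus.partialDeriv c (Torus.partialDeriv b (Torus.partialDeriv a (ρ t))) x| ≤ M * (1 + S₂ + S₃)) ∧
  Torus.HasDerivBoundsAt₃ (fun y => θ t y * (ζ (ρ t y) + ρ t y * deriv ζ (ρ t y)) / ρ t y) x M S₂ S₃ ∧
  Torus.HasDerivBoundsAt₃ (fun y => ζ (ρ t y)) x M S₂ S₃ ∧
  Torus.HasDerivBoundsAt₃ (fun y => θ t y * ζ (ρ t y)) x M S₂ S₃ ∧
  Torus.HasDerivBoundsAt₃ (fun y => ∑ i, Torus.partialDeriv i (fun z => u₁ t z i) y) x M S₂ S₃ ∧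
  (∀ i, Torus.HasDerivBoundsAt₃ (fun y => Torus.partialDeriv i (ρ₁ t) y) x M S₂ S₃) ∧
  (∀ i j, Torus.HasDerivBoundsAt₃ (fun y => Torus.partialDeriv i (fun z => u₁ t z j) y) x M S₂ S₃) ∧
  (∀ i, Torus.HasDerivBoundsAt₃ (fun y => Torus.partialDeriv i (θ₁ t) y) x M S₂ S₃) ∧
  (∀ j, Torus.HasDerivBoundsAt₃
    (fun y => (ζ (ρ t y) + ρ t y * deriv ζ (ρ t y)) / ρ t y * Torus.partialDeriv j (ρ₁ t) y) x M S₂ S₃) ∧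
  (∀ j, Torus.HasDerivBoundsAt₃
    (fun y => θ₁ t y / (ρ t y * ρ₁ t y) * Torus.partialDeriv j (ρ₁ t) y) x M S₂ S₃) ∧
  Torus.HasDerivBoundsAt₃
    (fun y => ζ (ρ t y) * ∑ i, Torus.partialDeriv i (fun z => u₁ t z i) y) x M S₂ S₃ ∧
  (∀ j, Torus.HasDerivBoundsAt₃
    (fun y => θ₁ t y * (ζ (ρ t y) + ρ t y * deriv ζ (ρ t y) - 1) / ρ t y * Torus.partialDeriv j (ρ₁ t) y +
      (ζ (ρ t y) - 1) * Torus.partialDeriv j (θ₁ t) y) x Z S₂ S₃) ∧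
  Torus.HasDerivBoundsAt₃
    (fun y => 2 / 3 * (θ₁ t y * (ζ (ρ t y) - 1)) * ∑ i, Torus.partialDeriv i (fun z => u₁ t z i) y) x Z S₂ S₃

/-- **Jets of `δV` of orders `0, 1, 2` at `x` bounded by `d₀, d₁, d₂`** (scalar coordinate forms). [folklore] -/
def Level3Jets (ρ θ ρ₁ θ₁ : ℝ → T3 → ℝ) (u u₁ : ℝ → T3 → V3) (t : ℝ) (x : T3) (d₀ d₁ d₂ : ℝ) : Prop :=
  |ρ t x - ρ₁ t x| ≤ d₀ ∧ |θ t x - θ₁ t x| ≤ d₀ ∧ (∀ i, |u t x i - u₁ t x i| ≤ d₀) ∧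
  (∀ a, |Torus.partialDeriv a (fun y => ρ t y - ρ₁ t y) x| ≤ d₁) ∧
  (∀ a, |Torus.partialDeriv a (fun y => θ t y - θ₁ t y) x| ≤ d₁) ∧
  (∀ i a, |Torus.partialDeriv a (fun y => u t y i - u₁ t y i) x| ≤ d₁) ∧
  (∀ a b, |Torus.partialDeriv b (Torus.partialDeriv a (fun y => ρ t y - ρ₁ t y)) x| ≤ d₂) ∧
  (∀ a b, |Torus.partialDeriv b (Torus.partialDeriv a (fun y => θ t y - θ₁ t y)) x| ≤ d₂) ∧
  (∀ i a b, |Torus.partialDeriv b (Torus.partialDeriv a (fun y => u t y i - u₁ t y i)) x| ≤ d₂)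

/-- Total second-derivative size of `δV` at `x`: `dsize₂ δρ + dsize₂ δθ + Σᵢ dsize₂ δuᵢ`. [folklore] -/
def l3q (ρ θ ρ₁ θ₁ : ℝ → T3 → ℝ) (u u₁ : ℝ → T3 → V3) (t : ℝ) (x : T3) : ℝ :=
  Torus.dsize₂ (fun y => ρ t y - ρ₁ t y) x + Torus.dsize₂ (fun y => θ t y - θ₁ t y) x +
    ∑ i, Torus.dsize₂ (fun y => u t y i - u₁ t y i) x

/-- Total third-derivative size of `δV` at `x`: `dsize₃ δρ + dsize₃ δθ + Σᵢ dsize₃ δuᵢ`. [folklore] -/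
def l3n (ρ θ ρ₁ θ₁ : ℝ → T3 → ℝ) (u u₁ : ℝ → T3 → V3) (t : ℝ) (x : T3) : ℝ :=
  Torus.dsize₃ (fun y => ρ t y - ρ₁ t y) x + Torus.dsize₃ (fun y => θ t y - θ₁ t y) x +
    ∑ i, Torus.dsize₃ (fun y => u t y i - u₁ t y i) x

/-- Energy density of `W = ∂ₙ∂ₘ∂ₗ δV` as a space–time field: `½(A W_ρ² + ρ‖W_u‖² + B W_θ²)`
(summing over `(l, m, n)` gives the integrand of `shadowE3`). [folklore] -/
def l3e (ζ : ℝ → ℝ) (ρ θ ρ₁ θ₁ : ℝ → T3 → ℝ) (u u₁ : ℝ → T3 → V3) (l m n : Fin 3) : ℝ → T3 → ℝ :=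
  fun s y => 1 / 2 *
    (θ s y * (ζ (ρ s y) + ρ s y * deriv ζ (ρ s y)) / ρ s y *
        Torus.partialDeriv n (Torus.partialDeriv m (Torus.partialDeriv l (fun y' => ρ s y' - ρ₁ s y'))) y ^ 2 +
      ρ s y * ‖Torus.partialDeriv n (Torus.partialDeriv m (Torus.partialDeriv l (fun y' => u s y' - u₁ s y'))) y‖ ^ 2 +
      3 / 2 * ρ s y / θ s y *
        Torus.partialDeriv n (Torus.partialDeriv m (Torus.partialDeriv l (fun y' => θ s y' - θ₁ s y'))) y ^ 2)

/-- The `i`-th flux of the energy density of `W` at time `t` (`Φᵢ` of `hsEuler_frozen_energy_identity` at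
`(α, w, β) = W`). [folklore] -/
def l3flux (ζ : ℝ → ℝ) (ρ θ ρ₁ θ₁ : ℝ → T3 → ℝ) (u u₁ : ℝ → T3 → V3) (t : ℝ) (l m n i : Fin 3) : T3 → ℝ :=
  fun y =>
    1 / 2 * (θ t y * (ζ (ρ t y) + ρ t y * deriv ζ (ρ t y)) / ρ t y * u t y i *
          Torus.partialDeriv n (Torus.partialDeriv m (Torus.partialDeriv l (fun y' => ρ t y' - ρ₁ t y'))) y ^ 2 +
        ρ t y * u t y i * ‖Torus.partialDeriv n (Torus.partialDeriv m (Torus.partialDeriv l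
          (fun y' => u t y' - u₁ t y'))) y‖ ^ 2 +
        3 / 2 * ρ t y / θ t y * u t y i *
          Torus.partialDeriv n (Torus.partialDeriv m (Torus.partialDeriv l (fun y' => θ t y' - θ₁ t y'))) y ^ 2) +
      θ t y * (ζ (ρ t y) + ρ t y * deriv ζ (ρ t y)) *
        Torus.partialDeriv n (Torus.partialDeriv m (Torus.partialDeriv l (fun y' => ρ t y' - ρ₁ t y'))) y *
        Torus.partialDeriv n (Torus.partialDeriv m (Torus.partialDeriv l (fun y' => u t y' - u₁ t y'))) y i +
      ρ t y * ζ (ρ t y) *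
        Torus.partialDeriv n (Torus.partialDeriv m (Torus.partialDeriv l (fun y' => θ t y' - θ₁ t y'))) y *
        Torus.partialDeriv n (Torus.partialDeriv m (Torus.partialDeriv l (fun y' => u t y' - u₁ t y'))) y i

/-- Energies of the commutator jets of the word `(l, m, n)` at `(t, x)`:
`½ Σᵢ [e(∂ₙ∂ₘ∂ᵢ δV) + e(∂ₙ∂ᵢ∂ₗ δV) + e(∂ᵢ∂ₘ∂ₗ δV)]`. [folklore] -/
def l3Y (ζ : ℝ → ℝ) (ρ θ ρ₁ θ₁ : ℝ → T3 → ℝ) (u u₁ : ℝ → T3 → V3) (t : ℝ) (x : T3) (l m n : Fin 3) : ℝ :=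
  ∑ i, (l3e ζ ρ θ ρ₁ θ₁ u u₁ i m n t x + l3e ζ ρ θ ρ₁ θ₁ u u₁ l i n t x + l3e ζ ρ θ ρ₁ θ₁ u u₁ l m i t x)

/-- Weighted magnitude of `W` at `(t, x)`: `√A |W_ρ| + √ρ ‖W_u‖ + √B |W_θ|`. [folklore] -/
def l3Nw (ζ : ℝ → ℝ) (ρ θ ρ₁ θ₁ : ℝ → T3 → ℝ) (u u₁ : ℝ → T3 → V3) (t : ℝ) (x : T3) (l m n : Fin 3) : ℝ :=
  Real.sqrt (θ t x * (ζ (ρ t x) + ρ t x * deriv ζ (ρ t x)) / ρ t x) *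
      |Torus.partialDeriv n (Torus.partialDeriv m (Torus.partialDeriv l (fun y => ρ t y - ρ₁ t y))) x| +
    Real.sqrt (ρ t x) *
      ‖Torus.partialDeriv n (Torus.partialDeriv m (Torus.partialDeriv l (fun y => u t y - u₁ t y))) x‖ +
    Real.sqrt (3 / 2 * ρ t x / θ t x) *
      |Torus.partialDeriv n (Torus.partialDeriv m (Torus.partialDeriv l (fun y => θ t y - θ₁ t y))) x|

/-- Sum of the root weights at `(t, x)`: `√A + √ρ + √B`. [folklore] -/
def l3Ws (ζ : ℝ → ℝ) (ρ θ : ℝ → T3 → ℝ) (t : ℝ) (x : T3) : ℝ :=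
  Real.sqrt (θ t x * (ζ (ρ t x) + ρ t x * deriv ζ (ρ t x)) / ρ t x) + Real.sqrt (ρ t x) +
    Real.sqrt (3 / 2 * ρ t x / θ t x)

/-- `l3Nw` is nonnegative. [folklore] -/
theorem l3Nw_nonneg :
    ∀ {ζ : ℝ → ℝ} {ρ θ ρ₁ θ₁ : ℝ → T3 → ℝ} {u u₁ : ℝ → T3 → V3} {t : ℝ} {x : T3} {l m n : Fin 3},
      0 ≤ l3Nw ζ ρ θ ρ₁ θ₁ u u₁ t x l m n := by
  intro ζ ρ θ ρ₁ θ₁ u u₁ t x l m n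
  unfold l3Nw
  exact add_nonneg (add_nonneg (mul_nonneg (Real.sqrt_nonneg _) (abs_nonneg _))
    (mul_nonneg (Real.sqrt_nonneg _) (norm_nonneg _))) (mul_nonneg (Real.sqrt_nonneg _) (abs_nonneg _))

/-- `l3Rem` is monotone in `(M, Z, d₀, d₁, d₂)` and nonnegative for nonnegative arguments. [folklore] -/
theorem l3Rem_mono :
    ∀ {M M' Z Z' S₂ S₃ d₀ d₀' d₁ d₁' d₂ d₂' : ℝ}, 0 ≤ M → M ≤ M' → 0 ≤ Z → Z ≤ Z' → 0 ≤ S₂ → 0 ≤ S₃ →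
      0 ≤ d₀ → d₀ ≤ d₀' → 0 ≤ d₁ → d₁ ≤ d₁' → 0 ≤ d₂ → d₂ ≤ d₂' →
      0 ≤ l3Rem M Z S₂ S₃ d₀ d₁ d₂ ∧ l3Rem M Z S₂ S₃ d₀ d₁ d₂ ≤ l3Rem M' Z' S₂ S₃ d₀' d₁' d₂' := by
  intro M M' Z Z' S₂ S₃ d₀ d₀' d₁ d₁' d₂ d₂' hM hMM hZ hZZ hS₂ hS₃ hd₀ hd₀' hd₁ hd₁' hd₂ hd₂'
  unfold l3Rem
  constructor
  · positivity
  · have h1 : (d₀ + d₁) * (1 + S₂ + S₃) ≤ (d₀' + d₁') * (1 + S₂ + S₃) :=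
      mul_le_mul_of_nonneg_right (by linarith) (by positivity)
    have h2 : d₂ * (1 + S₂) ≤ d₂' * (1 + S₂) := mul_le_mul_of_nonneg_right hd₂' (by positivity)
    have h3 : 40 * M * ((d₀ + d₁) * (1 + S₂ + S₃) + d₂ * (1 + S₂)) ≤
        40 * M' * ((d₀' + d₁') * (1 + S₂ + S₃) + d₂' * (1 + S₂)) :=
      mul_le_mul (by linarith) (by linarith) (by positivity) (by linarith)
    have h4 : Z * (1 + S₂ + S₃) ≤ Z' * (1 + S₂ + S₃) := mul_le_mul_of_nonneg_right hZZ (by positivity)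
    linarith

end Summit.AtomisticToContinuum.HydrodynamicLimit.Theorems

end
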